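import Literature.Analysis.FluidPDE.DoeringFoiasAmplitudeProofs
import Literature.Analysis.FluidPDE.DoeringFoiasProofs
import HarnessLib

/-!
# Doering–Foias for a general steady force: the budget `ε ≤ ‖f‖₂ U`, the energy ceiling from a
# dissipation ratio, and the `ν`-uniform energy floor

Consequences of the discharged Doering–Foias facts of `Literature.Analysis.FluidPDE.DoeringFoias`
(`DoeringFoias2002_dissipation_le_power_holds`, `Torus.IsGlobalLerayHopf.meanPower_le`,
`DoeringFoias2002_amplitude_le_holds`) for a GENERAL smooth divergence-free mean-zero steady force
`f` on `T³` — not only for the scaled shape forces `F Φ(n • ·)`: every such `f ≠ 0` is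
`‖f‖₂ · Φ_f (1 • ·)` for the `L²`-normalised shape `Φ_f = f/‖f‖₂` (`exists_forcingShape_force_one_eq`), so the
shape-indexed facts apply verbatim. All long-time averages are the `limsup` averages of the tree
(`meanEnergy`, `meanDissipation`, `meanPower`).

* `exists_forcingShape_force_one_eq` — the normalised shape `Φ_f` of `f ≠ 0` with `‖f‖₂ · Φ_f(1 • x) = f`.
* `Torus.IsGlobalLerayHopf.meanDissipation_le_sqrt_mul_sqrt` — the Doering–Foias budget
  `ε ≤ ⟨f·u⟩ ≤ ‖f‖₂ U`, i.e. `meanDissipation ν u ≤ ‖f‖₂ · (meanEnergy u)^{1/2}`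
  (Cheskidov–Doering–Petrov 2007, eqs. (11), (17); Doering–Foias 2002, §2).
* `Torus.IsGlobalLerayHopf.sq_mul_meanEnergy_le_of_ratio` — a dissipation RATIO floor
  `θ ⟨‖u‖₂²⟩ ≤ ε` is an energy CEILING: `θ² ⟨‖u‖₂²⟩ ≤ ‖f‖₂²` (and `θ ε ≤ ‖f‖₂²`).
* `ForcingShape.exists_meanEnergy_floor`, `exists_meanEnergy_floor_of_isSmooth` — the lower bound on
  the r.m.s. velocity (Doering–Foias 2002, §3; Cheskidov–Doering–Petrov 2007, eqs. (18)–(19)): for a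
  fixed non-zero force there is `c = c(f) > 0` with `c ≤ meanEnergy u` for EVERY global Leray–Hopf
  solution of NS_ν(f) with `0 < ν ≤ 1` (any datum), from `‖f‖₂ ≤ a U² + b ν U`.

References: C. R. Doering, C. Foias, *Energy dissipation in body-forced turbulence*, J. Fluid Mech.
467 (2002) 289–306, §§2–3 [DoeringFoias2002]; A. Cheskidov, C. R. Doering, N. P. Petrov, *Energy
dissipation in fractal-forced flow*, J. Math. Phys. 48 (2007) 065208, §II eq. (11), §III eqs.
(17)–(19) [CheskidovDoeringPetrov2006].
-/

open MeasureTheory Filter Set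
open scoped ENNReal NNReal RealInnerProductSpace

noncomputable section

namespace Literature.Analysis.FluidPDE

variable {d : Type*} [Fintype d] [DecidableEq d]

/-! ### The normalised shape of a general force -/

/-- **Every non-zero steady force is a Doering–Foias shape force at scale `ℓ = 1`**: for a smooth
divergence-free mean-zero `f` on `T^d` with `‖f‖₂ > 0`, the `L²`-normalised field `Φ_f = f/‖f‖₂` is a
`ForcingShape` and `f = ‖f‖₂ · Φ_f(1 • ·)` (Doering–Foias 2002, §2: `f(x) = F Φ(x/ℓ)`, `‖Φ‖₂ = 1`,
`F = ‖f‖₂`), so the shape-indexed Doering–Foias facts apply to a general steady force. [cite: DoeringFoias2002, §2] -/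
theorem exists_forcingShape_force_one_eq {f : UnitAddTorus d → EuclideanSpace ℝ d}
    (hs : FunctionSpaces.Torus.IsSmooth f) (hd : FunctionSpaces.Torus.IsDivFree f)
    (hz : FunctionSpaces.Torus.HasZeroMean f) (hA : 0 < ∫ x, ‖f x‖ ^ 2) :
    ∃ Φ : ForcingShape d, Φ.shape = (Real.sqrt (∫ x, ‖f x‖ ^ 2))⁻¹ • f ∧
      Φ.force 1 (Real.sqrt (∫ x, ‖f x‖ ^ 2)) = f := by
  have hA' : 0 < Real.sqrt (∫ x, ‖f x‖ ^ 2) := Real.sqrt_pos.2 hA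
  have hdiv : FunctionSpaces.Torus.IsDivFree ((Real.sqrt (∫ x, ‖f x‖ ^ 2))⁻¹ • f) := fun x => by
    have h : FunctionSpaces.Torus.divergence ((Real.sqrt (∫ x, ‖f x‖ ^ 2))⁻¹ • f) x =
        (Real.sqrt (∫ x, ‖f x‖ ^ 2))⁻¹ * FunctionSpaces.Torus.divergence f x := by
      unfold FunctionSpaces.Torus.divergence FunctionSpaces.Torus.partialDeriv
        FunctionSpaces.Torus.lineDeriv
      rw [Finset.mul_sum]
      refine Finset.sum_congr rfl fun i _ => ?_
      simp only [Pi.smul_apply, PiLp.smul_apply, smul_eq_mul]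
      exact deriv_const_mul_field _
    rw [h, hd x, mul_zero]
  have hzero : FunctionSpaces.Torus.HasZeroMean ((Real.sqrt (∫ x, ‖f x‖ ^ 2))⁻¹ • f) := by
    show ∫ x, ((Real.sqrt (∫ x, ‖f x‖ ^ 2))⁻¹ • f) x = 0
    simp_rw [Pi.smul_apply, integral_smul]
    rw [show (∫ x, f x) = 0 from hz, smul_zero]
  have hone : ∫ x, ‖((Real.sqrt (∫ x, ‖f x‖ ^ 2))⁻¹ • f) x‖ ^ 2 = 1 := by
    simp_rw [Pi.smul_apply, norm_smul, mul_pow, integral_const_mul, Real.norm_eq_abs, abs_inv,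
      abs_of_pos hA', inv_pow, Real.sq_sqrt hA.le]
    exact inv_mul_cancel₀ hA.ne'
  refine ⟨⟨(Real.sqrt (∫ x, ‖f x‖ ^ 2))⁻¹ • f, hs.smul _, hdiv, hzero, hone⟩, rfl, ?_⟩
  funext x
  simp [ForcingShape.force, smul_smul, hA'.ne']

/-! ### The budget and the energy ceiling from a dissipation ratio (`T³`) -/

section Budget

variable {ν θ : ℝ} {f : UnitAddTorus (Fin 3) → EuclideanSpace ℝ (Fin 3)}
  {u₀ : UnitAddTorus (Fin 3) → EuclideanSpace ℝ (Fin 3)}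
  {u : ℝ → UnitAddTorus (Fin 3) → EuclideanSpace ℝ (Fin 3)}

/-- **The Doering–Foias budget `ε ≤ ‖f‖₂ U`** for a global Leray–Hopf solution of NS_ν(f), `ν > 0`,
`f` steady, smooth and mean zero: `meanDissipation ν u ≤ ‖f‖₂ (meanEnergy u)^{1/2}` — the power
balance inequality `ε ≤ ⟨f·u⟩` (`DoeringFoias2002_dissipation_le_power_holds`) followed by
`⟨f·u⟩ ≤ ‖f‖₂ U` (`Torus.IsGlobalLerayHopf.meanPower_le`). [cite: CheskidovDoeringPetrov2006, eq. (11) and eq. (17)] -/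
theorem Torus.IsGlobalLerayHopf.meanDissipation_le_sqrt_mul_sqrt (hν : 0 < ν)
    (hf : FunctionSpaces.Torus.IsSmooth f) (hf0 : FunctionSpaces.Torus.HasZeroMean f)
    (hu : Torus.IsGlobalLerayHopf ν (fun _ => f) u₀ u) :
    meanDissipation ν u ≤ Real.sqrt (∫ x, ‖f x‖ ^ 2) * Real.sqrt (meanEnergy u) := by
  have h1 := DoeringFoias2002_dissipation_le_power_holds hν (hf.memLp 2) hf0 u₀ u hu
  have h2 := hu.meanPower_le hν hf hf0
  rw [rmsVelocity_eq_sqrt_meanEnergy] at h2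
  exact h1.trans h2

/-- **A dissipation-ratio floor is an energy ceiling**: if `θ ⟨‖u‖₂²⟩ ≤ ε` with `θ ≥ 0` along a global
Leray–Hopf solution of NS_ν(f), then `θ² ⟨‖u‖₂²⟩ ≤ ‖f‖₂²` (from `ε ≤ ‖f‖₂ U`: `θ U² ≤ ‖f‖₂ U`). [cite: DoeringFoias2002, §2] -/
theorem Torus.IsGlobalLerayHopf.sq_mul_meanEnergy_le_of_ratio (hν : 0 < ν)
    (hf : FunctionSpaces.Torus.IsSmooth f) (hf0 : FunctionSpaces.Torus.HasZeroMean f)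
    (hu : Torus.IsGlobalLerayHopf ν (fun _ => f) u₀ u) (hθ : 0 ≤ θ)
    (hr : θ * meanEnergy u ≤ meanDissipation ν u) :
    θ ^ 2 * meanEnergy u ≤ ∫ x, ‖f x‖ ^ 2 := by
  have hE := meanEnergy_nonneg u
  have hA : 0 ≤ ∫ x, ‖f x‖ ^ 2 := integral_nonneg fun _ => sq_nonneg _
  have h := hr.trans (hu.meanDissipation_le_sqrt_mul_sqrt hν hf hf0)
  set s := Real.sqrt (meanEnergy u)
  set A := Real.sqrt (∫ x, ‖f x‖ ^ 2)
  have hs0 : 0 ≤ s := Real.sqrt_nonneg _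
  have hEs : meanEnergy u = s ^ 2 := (Real.sq_sqrt hE).symm
  have hAA : (∫ x, ‖f x‖ ^ 2) = A ^ 2 := (Real.sq_sqrt hA).symm
  rw [hEs] at h ⊢
  rw [hAA]
  nlinarith [sq_nonneg (θ * s - A), mul_nonneg hθ hs0, mul_le_mul_of_nonneg_left h hθ]

/-- Under a ratio floor `θ ⟨‖u‖₂²⟩ ≤ ε`, `θ ≥ 0`, the dissipation itself is capped: `θ ε ≤ ‖f‖₂²`
(`ε ≤ ‖f‖₂ U` and `θ U ≤ ‖f‖₂`). [cite: DoeringFoias2002, §2] -/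
theorem Torus.IsGlobalLerayHopf.mul_meanDissipation_le_of_ratio (hν : 0 < ν)
    (hf : FunctionSpaces.Torus.IsSmooth f) (hf0 : FunctionSpaces.Torus.HasZeroMean f)
    (hu : Torus.IsGlobalLerayHopf ν (fun _ => f) u₀ u) (hθ : 0 ≤ θ)
    (hr : θ * meanEnergy u ≤ meanDissipation ν u) :
    θ * meanDissipation ν u ≤ ∫ x, ‖f x‖ ^ 2 := by
  have hE := meanEnergy_nonneg u
  have hA : 0 ≤ ∫ x, ‖f x‖ ^ 2 := integral_nonneg fun _ => sq_nonneg _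
  have hD := hu.meanDissipation_le_sqrt_mul_sqrt hν hf hf0
  have hsq := hu.sq_mul_meanEnergy_le_of_ratio hν hf hf0 hθ hr
  set s := Real.sqrt (meanEnergy u)
  set A := Real.sqrt (∫ x, ‖f x‖ ^ 2)
  have hs0 : 0 ≤ s := Real.sqrt_nonneg _
  have hA0 : 0 ≤ A := Real.sqrt_nonneg _
  have hEs : meanEnergy u = s ^ 2 := (Real.sq_sqrt hE).symm
  have hAA : (∫ x, ‖f x‖ ^ 2) = A ^ 2 := (Real.sq_sqrt hA).symm
  rw [hEs] at hsq
  rw [hAA] at hsq ⊢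
  -- `θ s ≤ A`, hence `θ ε ≤ θ A s ≤ A²`
  have hθs : θ * s ≤ A := by
    have h1 : (θ * s) ^ 2 ≤ A ^ 2 := by rw [mul_pow]; exact hsq
    calc θ * s = Real.sqrt ((θ * s) ^ 2) := (Real.sqrt_sq (mul_nonneg hθ hs0)).symm
      _ ≤ Real.sqrt (A ^ 2) := Real.sqrt_le_sqrt h1
      _ = A := Real.sqrt_sq hA0
  calc θ * meanDissipation ν u ≤ θ * (A * s) := mul_le_mul_of_nonneg_left hD hθ
    _ = A * (θ * s) := by ring
    _ ≤ A * A := mul_le_mul_of_nonneg_left hθs hA0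
    _ = A ^ 2 := (sq A).symm

end Budget

/-! ### The `ν`-uniform energy floor (`T³`) -/

section Floor

/-- **Lower bound on the r.m.s. velocity, `ν`-uniform** (Doering–Foias 2002, §3; Cheskidov–Doering–
Petrov 2007, eqs. (18)–(19)): for a forcing shape `Φ`, a scale `ℓ = 1/n` and an amplitude `F ≠ 0`
there is `c > 0` (depending on `Φ, n, F` only) such that EVERY global Leray–Hopf solution of the
Navier–Stokes equations on `T³` forced by `F Φ(n • ·)` with viscosity `0 < ν ≤ 1` — any datum — has
`c ≤ ⟨‖u‖₂²⟩`: from `|F| ≤ a U²/ℓ + b ν U/ℓ²` either `U ≥ 1` or `|F| ≤ (a n + b n²) U`. [cite: DoeringFoias2002, §3] -/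
theorem ForcingShape.exists_meanEnergy_floor (Φ : ForcingShape (Fin 3)) {n : ℕ} (hn : 0 < n)
    {F : ℝ} (hF : F ≠ 0) :
    ∃ c : ℝ, 0 < c ∧ ∀ ⦃ν : ℝ⦄, 0 < ν → ν ≤ 1 →
      ∀ (u₀ : UnitAddTorus (Fin 3) → EuclideanSpace ℝ (Fin 3))
        (u : ℝ → UnitAddTorus (Fin 3) → EuclideanSpace ℝ (Fin 3)),
      Torus.IsGlobalLerayHopf ν (fun _ => Φ.force n F) u₀ u → c ≤ meanEnergy u := by
  obtain ⟨a, b, ha, hb, hab⟩ := DoeringFoias2002_amplitude_le_holds Φ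
  have hn' : (0 : ℝ) < n := by exact_mod_cast hn
  set K : ℝ := a * n + b * (n : ℝ) ^ 2 with hK
  have hK0 : 0 < K := by positivity
  have hq : 0 < |F| / K := div_pos (abs_pos.2 hF) hK0
  refine ⟨min 1 ((|F| / K) ^ 2), lt_min one_pos (by positivity), fun ν hν hν1 u₀ u hu => ?_⟩
  have h := hab hν hn F u₀ u hu
  set U := rmsVelocity longTimeAvgSup u with hU
  have hU0 : 0 ≤ U := Real.sqrt_nonneg _
  have hEU : meanEnergy u = U ^ 2 := by
    rw [hU, rmsVelocity_eq_sqrt_meanEnergy, Real.sq_sqrt (meanEnergy_nonneg u)]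
  have h' : |F| ≤ a * n * U ^ 2 + b * ν * (n : ℝ) ^ 2 * U := by
    have e1 : a * U ^ 2 / (n : ℝ)⁻¹ = a * n * U ^ 2 := by field_simp
    have e2 : b * ν * U / (n : ℝ)⁻¹ ^ 2 = b * ν * (n : ℝ) ^ 2 * U := by field_simp
    rw [e1, e2] at h
    exact h
  by_cases h1 : 1 ≤ U
  · calc min 1 ((|F| / K) ^ 2) ≤ 1 := min_le_left _ _
      _ ≤ U ^ 2 := by nlinarith
      _ = meanEnergy u := hEU.symm
  · push Not at h1
    have hU2 : U ^ 2 ≤ U := by nlinarith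
    have hνU : b * ν * (n : ℝ) ^ 2 * U ≤ b * (n : ℝ) ^ 2 * U := by
      have h3 := mul_le_mul_of_nonneg_right (mul_le_mul_of_nonneg_right
        (mul_le_mul_of_nonneg_left hν1 hb.le) (sq_nonneg (n : ℝ))) hU0
      simpa using h3
    have h2 : |F| ≤ K * U := by
      rw [hK]
      nlinarith [mul_le_mul_of_nonneg_left hU2 (by positivity : (0 : ℝ) ≤ a * n)]
    have h3 : |F| / K ≤ U := by
      rw [div_le_iff₀ hK0]
      linarith [mul_comm K U]
    calc min 1 ((|F| / K) ^ 2) ≤ (|F| / K) ^ 2 := min_le_right _ _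
      _ ≤ U ^ 2 := pow_le_pow_left₀ hq.le h3 2
      _ = meanEnergy u := hEU.symm

/-- **Energy floor for a general non-zero steady force** (Doering–Foias 2002, §3): for a smooth
divergence-free mean-zero `f` on `T³` with `‖f‖₂ > 0` there is `c = c(f) > 0` such that every global
Leray–Hopf solution of NS_ν(f), `0 < ν ≤ 1`, any datum, has `c ≤ ⟨‖u‖₂²⟩` — the shape floor
`ForcingShape.exists_meanEnergy_floor` for `Φ_f = f/‖f‖₂` (`exists_forcingShape_force_one_eq`), `F = ‖f‖₂`, `n = 1`. In particular no
vanishing-viscosity Leray–Hopf family at a fixed non-zero force has mean energy tending to `0`. [cite: DoeringFoias2002, §3] -/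
theorem exists_meanEnergy_floor_of_isSmooth {f : UnitAddTorus (Fin 3) → EuclideanSpace ℝ (Fin 3)}
    (hs : FunctionSpaces.Torus.IsSmooth f)
    (hd : FunctionSpaces.Torus.IsDivFree f) (hz : FunctionSpaces.Torus.HasZeroMean f)
    (hA : 0 < ∫ x, ‖f x‖ ^ 2) :
    ∃ c : ℝ, 0 < c ∧ ∀ ⦃ν : ℝ⦄, 0 < ν → ν ≤ 1 →
      ∀ (u₀ : UnitAddTorus (Fin 3) → EuclideanSpace ℝ (Fin 3))
        (u : ℝ → UnitAddTorus (Fin 3) → EuclideanSpace ℝ (Fin 3)),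
      Torus.IsGlobalLerayHopf ν (fun _ => f) u₀ u → c ≤ meanEnergy u := by
  have hF : Real.sqrt (∫ x, ‖f x‖ ^ 2) ≠ 0 := (Real.sqrt_pos.2 hA).ne'
  obtain ⟨Φ, -, hΦ⟩ := exists_forcingShape_force_one_eq hs hd hz hA
  obtain ⟨c, hc, hfloor⟩ := Φ.exists_meanEnergy_floor one_pos hF
  refine ⟨c, hc, fun ν hν hν1 u₀ u hu => hfloor hν hν1 u₀ u ?_⟩
  rw [hΦ]
  exact hu

end Floor


end Literature.Analysis.FluidPDE

end
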